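import Literature.Computability.Complexity.OracleCompositionUniform
import HarnessLib

/-!
# Polynomial-time subroutines against an ARBITRARY oracle: composition with time-local clamp bounds, clocked inner runs

Topic `Literature/Computability/Complexity`, companion of `OracleComposition.lean` (the composite
machine `OracleComposition.compose M N eb prm`: each query of the outer algorithm `M` is answered by
running the inner algorithm `N` with the base oracle `O`), `OracleCompositionMachine.lean`
(`OracleAlg.isPolyTime_compose_holds`: the composite is polynomial-time) and
`OracleCompositionUniform.lean` (`OracleAlg.exists_polyTime_compose_uniform`: the bookkeeping,
uniformly in the oracles; the clocked algorithm `M.clock q b₀`).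

The composition theorems of the tree ask that EVERY query the inner algorithm makes to `O` be of
length `≤ qN |u|`. That is the right hypothesis for the relativised classes (`P^{FP^O} = P^O`), but
it is NOT available when a reduction must run a black-box subroutine against an arbitrary oracle
`O : {0,1}* → {0,1}*` whose answers — hence the subroutine's later queries, which may copy them — are
of unbounded length; this is the situation of every "oracle-algorithm transformer" hypothesis in the
worst-case/average-case lattice reductions of `Cryptography/PeikertReduction.lean` (pqc.S20, the
first component `h₁` runs the BDD solver `R` polynomially many times against an arbitrary LWE
oracle), `Cryptography/BLPRSReduction.lean` (pqc.S21) and `Cryptography/RegevReduction.lean`. In the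
transcript model (`Oracle.lean`) such length bounds are in fact unnecessary: the step function of
the composite machine is allowed time polynomial in the length of ITS input `⟨x, answers⟩`, which
contains every answer of `O` received so far, and a polynomial-time step function emits strings of
length polynomial in what it has read (`OracleAlg.IsPolyTime.exists_length_le`). The simulation
theorem `OracleComposition.readout_iterate_G` only ever USES the clamp bound on the pending query;
this file records the time-local form and draws the consequences:

* `OracleComposition.readout_iterate_G_local`, `compose_step_eq_local`, `compose_runAux_eq_local` —
  the main simulation theorem and the specification of the composite machine with the clamp-bound
  hypothesis on the inner queries restricted to THE PENDING QUERY `Q[j]` (the `j`-th query of the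
  global sequence `Q = us.flatMap (N.queries O kN ·)`, when the answers to `Q[0..j)` are available);
  the other hypotheses are those of the tree (`readout_iterate_G`), the proof is the same induction.
* `OracleComposition.exists_block_of_lt_length_flatMap` — locating `Q[j]` in its block: `Q[j]` is the
  `k`-th query of `N` on `us[i]`, and the answers `N` has read before asking it are among the first
  `j` answers.
* **`OracleAlg.exists_polyTime_compose_local`** — composition, uniformly in the oracles and WITHOUT
  any bound on the inner queries: for polynomial-time `M` (outputs coded by `eb`), `N` (string
  outputs) and polynomials `qM`, `qN` there are a polynomial-time `C` and a polynomial `qC` such that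
  for all oracles `O`, `f`, inputs `x` and outputs `b`: if `M` with oracle `f` outputs `b` within
  `qM |x|` rounds asking queries of length `≤ qM |x|`, and on each of these queries `u` the algorithm
  `N` with oracle `O` outputs `f u` within `qN |u|` rounds, then `C` with oracle `O` outputs `b`
  within `qC |x|` rounds, and its transcript is the concatenation of the transcripts of `N`
  (`C = OracleComposition.compose M N eb prm` for suitable resource parameters).
* `OracleAlg.subAnswer R qR d₀ O` — the total answer function `u ↦` (output of `R` with oracle `O`
  within `qR |u|` rounds, or the default `d₀` on a timeout) realised by the CLOCKED subroutine
  `R.clock qR d₀` (`run_clock_subAnswer`); **`OracleAlg.exists_polyTime_subroutine`** — for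
  polynomial-time `M`, `R` and polynomials `qM`, `qR`: one polynomial-time `C` and polynomial `qC`
  such that for EVERY oracle `O`, whenever `M` with the oracle `subAnswer R qR d₀ O` outputs `b`
  within `qM |x|` rounds with queries of length `≤ qM |x|`, `C` with oracle `O` outputs `b` within
  `qC |x|` rounds ("call `R` as a subroutine with a time-out, polynomially many times, relative to any
  oracle": Arora–Barak 2009, §3.4 with §1.4.1; the form consumed by black-box reductions run against
  an adversarially specified oracle).

All proved (no named fact): Ladner–Lynch–Selman's "answer each query of the first procedure by
running the second" with Arora–Barak's clock, in the tree's transcript model.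

## References

* R. E. Ladner, N. A. Lynch, A. L. Selman, *A comparison of polynomial time reducibilities*,
  Theoret. Comput. Sci. 1 (1975) 103–123, §2 (Prop. 2.1, transitivity of `≤ᵀᴾ`)
  [LadnerLynchSelman1975].
* S. Arora, B. Barak, *Computational Complexity: A Modern Approach*, CUP 2009, §3.4 (oracle Turing
  machines), §1.4.1 (time-constructible clocks), Claim 1.6 / proof of Thm. 2.8 (polynomial-time
  computations compose) [AroraBarak2009].
* T. Baker, J. Gill, R. Solovay, *Relativizations of the P =? NP question*, SIAM J. Comput. 4 (1975),
  §1 [BakerGillSolovay1975].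
-/

namespace Literature.Computability.Complexity

open _root_.Computability Polynomial

namespace OracleComposition

variable {β : Type} {M : OracleAlg β} {N : OracleAlg (List Bool)} {eb : Encoding β Bool}

/-! ### Locating a global query in its block -/

/-- **Locating the `j`-th element of a `flatMap` in its block.** If `j < |us.flatMap g|` then for
some block index `i < |us|` and offset `k < |g us[i]|`, `us.flatMap g [j] = (g us[i])[k]`, the
blocks before `i` have total length `j - k ≤ j`, and the first `k` elements of the block are among
the first `j` elements of the `flatMap`. [folklore] -/
theorem exists_block_of_lt_length_flatMap {α γ : Type} (g : α → List γ) :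
    ∀ (us : List α) (j : ℕ) (hj : j < (us.flatMap g).length),
      ∃ (i : ℕ) (hi : i < us.length) (k : ℕ) (hk : k < (g (us[i])).length),
        ((us.take i).map fun u => (g u).length).sum + k = j ∧
        (us.flatMap g)[j] = (g (us[i]))[k] ∧
        ((g (us[i])).take k).Sublist ((us.flatMap g).take j)
  | [], j, hj => by simp at hj
  | u :: us', j, hj => by
    by_cases hju : j < (g u).length
    · refine ⟨0, by simp, j, by simpa using hju, by simp, ?_, ?_⟩
      · simp only [List.flatMap_cons, List.getElem_cons_zero]
        exact List.getElem_append_left hju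
      · simp only [List.flatMap_cons, List.getElem_cons_zero]
        rw [List.take_append_of_le_length hju.le]
    · push Not at hju
      have hj' : j - (g u).length < (us'.flatMap g).length := by
        simp only [List.flatMap_cons, List.length_append] at hj
        omega
      obtain ⟨i, hi, k, hk, hsum, hget, hsub⟩ :=
        exists_block_of_lt_length_flatMap g us' (j - (g u).length) hj'
      refine ⟨i + 1, by simpa using hi, k, by simpa using hk, ?_, ?_, ?_⟩
      · simp only [List.take_succ_cons, List.map_cons, List.sum_cons]
        omega
      · simp only [List.flatMap_cons, List.getElem_cons_succ]
        rw [List.getElem_append_right (by omega)]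
        exact hget
      · simp only [List.flatMap_cons, List.getElem_cons_succ]
        rw [List.take_append, List.take_of_length_le hju]
        exact hsub.trans (List.sublist_append_right _ _)

/-! ### The main simulation theorem with a time-local clamp hypothesis -/

section Local

variable (O f : Oracle) (kN : ℕ)

/-- **Main simulation theorem, time-local form.** As `readout_iterate_G`, except that the clamp
bound is required of the PENDING query `Q[j]` only (`Q = us.flatMap (N.queries O kN ·)`, the answers
to `Q[0..j)` being available), not of every query of the inner algorithm: started in phase `runM`
with transcript `pre`, the machine ends reporting `Q[j]` if `j < |Q|` and the output `b` if
`j = |Q|`. (The tree's proof uses its uniform hypothesis at the pending query alone; same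
induction.) [Ladner–Lynch–Selman 1975, §2; Arora–Barak 2009, §3.4]
[cite: LadnerLynchSelman1975, §2] [cite: AroraBarak2009, §3.4] -/
theorem readout_iterate_G_local (x : List Bool) (b : β) :
    ∀ (us pre : List (List Bool)) (s : State β) (j T : ℕ),
      (∀ (i : ℕ) (hi : i < us.length), M.step x (pre ++ (us.take i).map f) = Sum.inl (us[i])) →
      M.step x (pre ++ us.map f) = Sum.inr b →
      (∀ u ∈ us, N.run O kN u = some (f u)) →
      (∀ u ∈ us, u.length ≤ s.bnd) →
      (∀ hj : j < (us.flatMap fun u => N.queries O kN u).length,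
        ((us.flatMap fun u => N.queries O kN u)[j]).length ≤ s.bnd) →
      (∀ (i : ℕ) (hi : i < us.length),
        ((us.take (i + 1)).map fun u => (N.queries O kN u).length).sum ≤ j →
          (f (us[i])).length ≤ s.bnd) →
      (((us.map fun u => (N.queries O kN u).length).sum ≤ j) → (eb.encode b).length ≤ s.bnd) →
      s.phase = .runM → s.x = x → s.fAns = pre →
      s.rest = ((us.flatMap fun u => N.queries O kN u).take j).map O →
      j ≤ (us.flatMap fun u => N.queries O kN u).length →
      (us.map fun u => (N.queries O kN u).length + 2).sum + 1 ≤ s.pad →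
      (us.map fun u => (N.queries O kN u).length + 1).sum + 1 ≤ T →
      readout ((G M N eb)^[T] s) =
        if h : j < (us.flatMap fun u => N.queries O kN u).length then
          Sum.inl ((us.flatMap fun u => N.queries O kN u)[j]) else Sum.inr b
  | [], pre, s, j, T, _, hout, _, _, _, _, hb, hph, hx, hf, hr, hj, hpad, hT => by
    simp only [List.flatMap_nil, List.length_nil, Nat.le_zero] at hj
    subst hj
    obtain ⟨T', rfl⟩ : ∃ T', T = T' + 1 := ⟨T - 1, by simp at hT; omega⟩
    have hM : M.step s.x s.fAns = Sum.inr b := by rw [hx, hf]; simpa using hout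
    have hdone := G_output (N := N) s b hM hph (by simp at hpad; omega) (hb (by simp))
    rw [Function.iterate_succ_apply, iterate_G_of_doneOut _ b hdone]
    simp [readout, hdone]
  | u :: us', pre, s, j, T, hstep, hout, hN, hub, hqb, hfb, hb, hph, hx, hf, hr, hj, hpad, hT => by
    -- the trace of `N` on `u`
    obtain ⟨vs, -, hv, hvo, hvs⟩ :=
      N.exists_trace_of_runAux O u kN [] (f u) (hN u (by simp))
    simp only [List.nil_append] at hv hvo
    have hq : N.queries O kN u = vs := hvs
    simp only [List.flatMap_cons, List.map_cons, List.sum_cons, hq, List.length_append]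
      at hr hj hpad hT hqb ⊢
    -- the outer machine asks `u`
    have hM : M.step s.x s.fAns = Sum.inl u := by
      have h0 := hstep 0 (by simp)
      rw [List.getElem_cons_zero] at h0
      rw [hx, hf]; simpa using h0
    have hu := hub u (by simp)
    by_cases hjv : j < vs.length
    · -- the available answers run out while `N` works on `u`: pending query `vs[j]`
      have hr' : s.rest = (vs.take j).map O := by
        rw [hr, List.take_append_of_le_length hjv.le]
      have hqj : (vs[j]).length ≤ s.bnd := by
        have h := hqb (by omega)
        rwa [List.getElem_append_left hjv] at h
      obtain ⟨s', hs', hph', hout'⟩ := iterate_G_query_partial O s u vs j hjv hM hu hv hph hr'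
        (by omega) hqj
      obtain ⟨T', rfl⟩ : ∃ T', T = T' + (j + 1) := ⟨T - (j + 1), by omega⟩
      rw [Function.iterate_add_apply, hs', iterate_G_of_doneQuery s' hph',
        dif_pos (by omega)]
      simp [readout, hph', hout', List.getElem_append_left hjv]
    · -- `N` finishes on `u`: the answer `f u` is appended and the simulation continues
      push Not at hjv
      have hfu : (f u).length ≤ s.bnd := by
        have := hfb 0 (by simp) (by simpa [hq] using hjv)
        rwa [List.getElem_cons_zero] at this
      have hr' : s.rest = vs.map O ++
          (((us'.flatMap fun u => N.queries O kN u).take (j - vs.length)).map O) := by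
        rw [hr, List.take_append, List.take_of_length_le hjv, List.map_append]
      have hA := iterate_G_query (eb := eb) O s u (f u) vs _ hM hu hv hvo hfu hph hr' (by omega)
      obtain ⟨T', rfl⟩ : ∃ T', T = T' + (vs.length + 1) := ⟨T - (vs.length + 1), by omega⟩
      rw [Function.iterate_add_apply, hA]
      have ih := readout_iterate_G_local x b us' (pre ++ [f u])
        { s with fAns := s.fAns ++ [f u], u := [], nAns := [],
                 rest := (((us'.flatMap fun u => N.queries O kN u).take (j - vs.length)).map O),
                 pad := s.pad - (vs.length + 2) } (j - vs.length) T'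
        (fun i hi => by
          have h1 := hstep (i + 1) (by simpa using hi)
          rw [List.getElem_cons_succ] at h1
          simpa [List.take_succ_cons, List.append_assoc] using h1)
        (by simpa [List.append_assoc] using hout)
        (fun u' hu' => hN u' (by simp [hu'])) (fun u' hu' => hub u' (by simp [hu']))
        (fun hj' => by
          have h := hqb (by omega)
          rw [List.getElem_append_right hjv] at h
          simpa only using h)
        (fun i hi hsum => by
          have h1 := hfb (i + 1) (by simpa using hi)
            (by simpa [List.take_succ_cons, hq] using Nat.add_le_of_le_sub' hjv hsum)
          rwa [List.getElem_cons_succ] at h1)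
        (fun hsum => hb (by simpa [hq] using Nat.add_le_of_le_sub' hjv hsum))
        hph hx (by simp [hf]) rfl (by omega) (by simp only; omega) (by omega)
      rw [ih]
      by_cases hj' : j - vs.length < (us'.flatMap fun u => N.queries O kN u).length
      · rw [dif_pos hj', dif_pos (by omega)]
        congr 1
        rw [List.getElem_append_right (by omega)]
      · rw [dif_neg hj', dif_neg (by omega)]

/-- **Specification of the composite step function, time-local form** (cf. `compose_step_eq`):
on input `x` and the answers to `Q[0..j)`, the step function of `compose M N eb prm` reports
`Q[j]` (or the output `b` when `j = |Q|`), provided the clamp bound at this stage dominates the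
queries of `M`, the pending query `Q[j]`, the answers of `f` to the completed queries and (at the
end) the code of `b`, and fuel and micro-steps suffice. [Ladner–Lynch–Selman 1975, §2; Arora–Barak
2009, §3.4] [cite: LadnerLynchSelman1975, §2] -/
theorem compose_step_eq_local (prm : Params) (x : List Bool) (b : β) (us : List (List Bool))
    (hstep : ∀ (i : ℕ) (hi : i < us.length), M.step x ((us.take i).map f) = Sum.inl (us[i]))
    (hout : M.step x (us.map f) = Sum.inr b) (hN : ∀ u ∈ us, N.run O kN u = some (f u))
    (j : ℕ) (hj : j ≤ (us.flatMap fun u => N.queries O kN u).length) {n : ℕ}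
    (hn : n = inputLength x (((us.flatMap fun u => N.queries O kN u).take j).map O))
    (hub : ∀ u ∈ us, u.length ≤ prm.bndOf n)
    (hqb : ∀ hj : j < (us.flatMap fun u => N.queries O kN u).length,
      ((us.flatMap fun u => N.queries O kN u)[j]).length ≤ prm.bndOf n)
    (hfb : ∀ (i : ℕ) (hi : i < us.length),
      ((us.take (i + 1)).map fun u => (N.queries O kN u).length).sum ≤ j →
        (f (us[i])).length ≤ prm.bndOf n)
    (hb : ((us.map fun u => (N.queries O kN u).length).sum ≤ j) →
      (eb.encode b).length ≤ prm.bndOf n)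
    (hpad : (us.map fun u => (N.queries O kN u).length + 2).sum + 1 ≤ prm.padOf n)
    (hT : (us.map fun u => (N.queries O kN u).length + 1).sum + 1 ≤ prm.iterOf n) :
    (compose M N eb prm).step x (((us.flatMap fun u => N.queries O kN u).take j).map O) =
      if h : j < (us.flatMap fun u => N.queries O kN u).length then
        Sum.inl ((us.flatMap fun u => N.queries O kN u)[j]) else Sum.inr b := by
  subst hn
  exact readout_iterate_G_local O f kN x b us [] (initState prm x _) j _ (by simpa using hstep)
    (by simpa using hout) hN hub hqb hfb hb rfl rfl rfl rfl hj hpad hT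

/-- **The composite algorithm computes `M^f` with oracle `O`, time-local form** (cf.
`compose_runAux_eq`): under the hypotheses of `compose_step_eq_local` for every `j ≤ |Q|`, a run of
`compose M N eb prm` with oracle `O` and fuel `> |Q|` returns the output `b` of `M` with oracle `f`,
and its transcript is `Q`. [Ladner–Lynch–Selman 1975, §2; Baker–Gill–Solovay 1975, §1]
[cite: LadnerLynchSelman1975, §2] -/
theorem compose_runAux_eq_local (prm : Params) (x : List Bool) (b : β) (us : List (List Bool))
    (hstep : ∀ (i : ℕ) (hi : i < us.length), M.step x ((us.take i).map f) = Sum.inl (us[i]))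
    (hout : M.step x (us.map f) = Sum.inr b) (hN : ∀ u ∈ us, N.run O kN u = some (f u))
    (hprm : ∀ j ≤ (us.flatMap fun u => N.queries O kN u).length, ∀ n : ℕ,
      n = inputLength x (((us.flatMap fun u => N.queries O kN u).take j).map O) →
      (∀ u ∈ us, u.length ≤ prm.bndOf n) ∧
      (∀ hj : j < (us.flatMap fun u => N.queries O kN u).length,
        ((us.flatMap fun u => N.queries O kN u)[j]).length ≤ prm.bndOf n) ∧
      (∀ (i : ℕ) (hi : i < us.length),
        ((us.take (i + 1)).map fun u => (N.queries O kN u).length).sum ≤ j →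
          (f (us[i])).length ≤ prm.bndOf n) ∧
      (((us.map fun u => (N.queries O kN u).length).sum ≤ j) →
        (eb.encode b).length ≤ prm.bndOf n) ∧
      (us.map fun u => (N.queries O kN u).length + 2).sum + 1 ≤ prm.padOf n ∧
      (us.map fun u => (N.queries O kN u).length + 1).sum + 1 ≤ prm.iterOf n)
    {K : ℕ} (hK : (us.flatMap fun u => N.queries O kN u).length < K) :
    (compose M N eb prm).runAux O x K [] = some b ∧
      (compose M N eb prm).queriesAux O x K [] = us.flatMap fun u => N.queries O kN u := by
  refine (compose M N eb prm).runAux_of_trace O x _ [] b K (fun i hi => ?_) ?_ hK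
  · obtain ⟨h1, h2, h3, h4, h5, h6⟩ := hprm i hi.le _ rfl
    rw [List.nil_append, compose_step_eq_local O f kN prm x b us hstep hout hN i hi.le rfl h1 h2
      h3 h4 h5 h6, dif_pos hi]
  · obtain ⟨h1, h2, h3, h4, h5, h6⟩ := hprm _ le_rfl _ rfl
    have := compose_step_eq_local O f kN prm x b us hstep hout hN _ le_rfl rfl h1 h2 h3 h4 h5 h6
    rw [List.take_length] at this
    rw [List.nil_append, this, dif_neg (lt_irrefl _)]

end Local

end OracleComposition

namespace OracleAlg

variable {β : Type}

/-! ### Composition, uniformly in the oracles, without bounds on the inner queries -/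

/-- **Composition of polynomial-time oracle algorithms against arbitrary oracles.** For
polynomial-time `M` (outputs coded by `eb`) and `N` (string outputs) and polynomials `qM`, `qN`
there are a polynomial-time oracle algorithm `C` and a polynomial `qC` such that, for every pair of
oracles `O`, `f`, every input `x` and output `b`: if `M` with oracle `f` outputs `b` within `qM |x|`
rounds asking queries of length `≤ qM |x|`, and on every query `u` of that run `N` with oracle `O`
outputs `f u` within `qN |u|` rounds — with NO hypothesis on the queries `N` asks `O`, whose answers
may be arbitrarily long — then `C` with oracle `O` outputs `b` within `qC |x|` rounds, and its
transcript is the concatenation of the transcripts of `N` on the successive queries of `M`. (The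
pending query of `N` is a value of its polynomial-time step function on the answers received so
far, which are part of the input of the composite step function: `exists_block_of_lt_length_flatMap`,
`IsPolyTime.exists_length_le`.) [Ladner–Lynch–Selman 1975, §2; Arora–Barak 2009, §3.4 with
Claim 1.6] [cite: LadnerLynchSelman1975, §2] [cite: AroraBarak2009, §3.4] -/
theorem exists_polyTime_compose_local {eb : Encoding β Bool} {M : OracleAlg β}
    (hM : M.IsPolyTime eb) {N : OracleAlg (List Bool)} (hN : N.IsPolyTime (encodingList Bool))
    (qM qN : Polynomial ℕ) :
    ∃ C : OracleAlg β, C.IsPolyTime eb ∧ ∃ qC : Polynomial ℕ,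
      ∀ (O f : Oracle) (x : List Bool) (b : β),
        M.run f (qM.eval x.length) x = some b →
        (∀ y ∈ M.queries f (qM.eval x.length) x, y.length ≤ qM.eval x.length) →
        (∀ u ∈ M.queries f (qM.eval x.length) x, N.run O (qN.eval u.length) u = some (f u)) →
        C.run O (qC.eval x.length) x = some b ∧
          C.queries O (qC.eval x.length) x =
            (M.queries f (qM.eval x.length) x).flatMap fun u => N.queries O (qN.eval u.length) u := by
  classical
  obtain ⟨RM, hRM⟩ := hM.exists_length_le
  obtain ⟨RN, hRN⟩ := hN.exists_length_le
  -- the bounding polynomials (in the input length `n ≥ |x|` of the composite step function)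
  let Kq : Polynomial ℕ := qN.comp qM
  let E : Polynomial ℕ := 2 * qM + 2 + Polynomial.X
  let F : Polynomial ℕ := RN.comp E
  let Lb : Polynomial ℕ := 2 * qM + 2 + qM * (2 * F + 2)
  let B : Polynomial ℕ := RM.comp (2 * Polynomial.X + 2 + Lb)
  let Pd : Polynomial ℕ := qM * (Kq + 2) + 1
  let P : Polynomial ℕ := qM + Kq + F + B + Pd
  obtain ⟨prm, hprm, hC⟩ := isPolyTime_compose_holds β eb M N hM hN P
  refine ⟨OracleComposition.compose M N eb prm, hC, qM * Kq + Kq + 1,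
    fun O f x b hMrun hMq hNrun => ?_⟩
  set m := x.length with hm
  -- the trace of `M` with oracle `f` on `x`
  obtain ⟨us, huslen, hstep, hout, hus⟩ := M.exists_trace_of_runAux f x (qM.eval m) [] b hMrun
  simp only [List.nil_append] at hstep hout
  have hqueries : M.queries f (qM.eval m) x = us := hus
  have hmem : ∀ u ∈ us, u ∈ M.queries f (qM.eval m) x := fun u hu => by
    rw [hqueries]; exact hu
  have hub : ∀ u ∈ us, u.length ≤ qM.eval m := fun u hu => hMq u (hmem u hu)
  -- `N` computes `f` on every query of `M`, within `kN` rounds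
  set kN := Kq.eval m with hkN
  have hkN' : ∀ u ∈ us, qN.eval u.length ≤ kN := fun u hu => by
    rw [hkN]; simpa [Kq] using TM2Iter.eval_mono qN (hub u hu)
  have hNrun' : ∀ u ∈ us, N.run O kN u = some (f u) := fun u hu =>
    N.run_mono O u (hkN' u hu) (hNrun u (hmem u hu))
  have hNqs : ∀ u ∈ us, N.queries O kN u = N.queries O (qN.eval u.length) u := fun u hu =>
    N.queriesAux_eq_of_runAux_eq_some O u (hkN' u hu) (hNrun u (hmem u hu))
  have hvlen : ∀ u ∈ us, (N.queries O kN u).length < kN := fun u hu => by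
    obtain ⟨ws, hw, -, -, hws⟩ := N.exists_trace_of_runAux O u kN [] (f u) (hNrun' u hu)
    rw [OracleAlg.queries, hws]; exact hw
  -- size of the global query sequence
  have hQlen : (us.flatMap fun u => N.queries O kN u).length ≤ qM.eval m * kN := by
    rw [List.length_flatMap]
    exact (OracleComposition.sum_map_le_length_mul us _ kN fun u hu => (hvlen u hu).le).trans
      (Nat.mul_le_mul_right _ huslen.le)
  have hK : (us.flatMap fun u => N.queries O kN u).length < (qM * Kq + Kq + 1).eval m := by
    simp only [Polynomial.eval_add, Polynomial.eval_mul, Polynomial.eval_one, ← hkN]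
    nlinarith [hQlen]
  -- the run of the composite machine
  have hrun := OracleComposition.compose_runAux_eq_local (eb := eb) O f kN prm x b us hstep hout
    hNrun' ?_ hK
  · refine ⟨hrun.1, ?_⟩
    rw [OracleAlg.queries, hrun.2, hqueries]
    exact List.flatMap_congr fun u hu => hNqs u hu
  -- the resource parameters suffice at every stage `j`
  intro j hj n hn
  have hmn : m ≤ n := by rw [hn, OracleComposition.inputLength_eq]; omega
  have hPb : P.eval n ≤ prm.bndOf n := (hprm n).1
  have hPeval : P.eval n = qM.eval n + Kq.eval n + F.eval n + B.eval n + Pd.eval n := by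
    simp [P]
  have hA : qM.eval m ≤ qM.eval n := TM2Iter.eval_mono qM hmn
  have hansn : ((encodingList Bool).listBool.encode
      (((us.flatMap fun u => N.queries O kN u).take j).map O)).length ≤ n := by
    rw [hn, OracleComposition.inputLength_eq]; omega
  -- a value of the step function of `N` on `u ∈ us` after answers among the available ones is short
  have hNval : ∀ u ∈ us, ∀ ans : List (List Bool),
      (ans.map O).Sublist (((us.flatMap fun u => N.queries O kN u).take j).map O) →
        (((encodingList Bool).sumBool (encodingList Bool)).encode (N.step u (ans.map O))).length ≤
          F.eval n := by
    intro u hu ans hsub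
    have h1 := hRN u (ans.map O)
    have h2 : (boolPair u ((encodingList Bool).listBool.encode (ans.map O))).length ≤ E.eval n := by
      rw [length_boolPair]
      have := OracleComposition.length_listBool_encode_le_of_sublist hsub
      have := hub u hu
      simp only [E, Polynomial.eval_add, Polynomial.eval_mul, Polynomial.eval_ofNat,
        Polynomial.eval_X]
      omega
    have h3 : RN.eval (boolPair u ((encodingList Bool).listBool.encode (ans.map O))).length ≤
        F.eval n := by
      simp only [F, Polynomial.eval_comp]
      exact TM2Iter.eval_mono RN h2
    exact h1.trans h3
  -- (3) answers of `f` to completed queries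
  have hfb : ∀ (i : ℕ) (hi : i < us.length),
      ((us.take (i + 1)).map fun u => (N.queries O kN u).length).sum ≤ j →
        (f (us[i])).length + 1 ≤ F.eval n := by
    intro i hi hsum
    set u := us[i] with hu_def
    have hu : u ∈ us := List.getElem_mem hi
    obtain ⟨ws, -, -, hwo, hws⟩ := N.exists_trace_of_runAux O u kN [] (f u) (hNrun' u hu)
    simp only [List.nil_append] at hwo
    have hws' : N.queries O kN u = ws := hws
    -- the answers fed to `N` on `u` are among the available answers
    have hsub : (ws.map O).Sublist (((us.flatMap fun u => N.queries O kN u).take j).map O) := by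
      rw [← hws']
      exact (OracleComposition.sublist_take_flatMap us (fun u => N.queries O kN u) i j hi hsum).map O
    have h1 := hNval u hu ws hsub
    rw [hwo] at h1
    have h4 : (((encodingList Bool).sumBool (encodingList Bool)).encode
        (Sum.inr (f u) : List Bool ⊕ List Bool)).length = (f u).length + 1 := by
      simp [Encoding.sumBool, encodingList]
    omega
  refine ⟨fun u hu => (hub u hu).trans (hA.trans (by omega)), fun hjlt => ?_,
    fun i hi hsum => by have := hfb i hi hsum; omega, fun hsum => ?_, ?_, ?_⟩
  · -- (2) the pending query `Q[j]`: a query of `N` on its block, after available answers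
    obtain ⟨i, hi, k, hk, -, hget, hsub⟩ :=
      OracleComposition.exists_block_of_lt_length_flatMap (fun u => N.queries O kN u) us j hjlt
    have hu : us[i] ∈ us := List.getElem_mem hi
    obtain ⟨ws, -, hwst, -, hws⟩ := N.exists_trace_of_runAux O (us[i]) kN [] (f (us[i])) (hNrun' _ hu)
    simp only [List.nil_append] at hwst
    have hws' : N.queries O kN (us[i]) = ws := hws
    have hk' : k < ws.length := by rw [← hws']; exact hk
    have hQj : (us.flatMap fun u => N.queries O kN u)[j] = ws[k] := by
      rw [hget]; exact List.getElem_of_eq hws' hk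
    have hsub' : ((ws.take k).map O).Sublist
        (((us.flatMap fun u => N.queries O kN u).take j).map O) := by
      rw [← hws']; exact hsub.map O
    have h1 := hNval _ hu (ws.take k) hsub'
    rw [hwst k hk'] at h1
    have h4 : (((encodingList Bool).sumBool (encodingList Bool)).encode
        (Sum.inl (ws[k]) : List Bool ⊕ List Bool)).length = (ws[k]).length + 1 := by
      simp [Encoding.sumBool, encodingList]
    rw [hQj]
    omega
  · -- (4) the output of `M`
    have hall : ∀ (i : ℕ) (hi : i < us.length), (f (us[i])).length + 1 ≤ F.eval n := by
      intro i hi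
      refine hfb i hi ((List.Sublist.sum_le_sum ?_ (fun _ _ => Nat.zero_le _)).trans hsum)
      exact (List.take_sublist _ _).map _
    have hLb : ((encodingList Bool).listBool.encode (us.map f)).length ≤ Lb.eval n := by
      rw [OracleComposition.length_listBool_encode, List.length_map, List.map_map]
      have hs : (us.map ((fun a : List Bool => 2 * a.length + 2) ∘ f)).sum ≤
          us.length * (2 * F.eval n + 2) := by
        refine OracleComposition.sum_map_le_length_mul us _ _ fun u hu => ?_
        obtain ⟨i, hi, rfl⟩ := List.getElem_of_mem hu
        have := hall i hi
        simp only [Function.comp_apply]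
        omega
      have hl : us.length * (2 * F.eval n + 2) ≤ qM.eval n * (2 * F.eval n + 2) :=
        Nat.mul_le_mul_right _ (huslen.le.trans hA)
      simp only [Lb, Polynomial.eval_add, Polynomial.eval_mul, Polynomial.eval_ofNat]
      omega
    have h1 := hRM x (us.map f)
    rw [hout] at h1
    have h2 : (boolPair x ((encodingList Bool).listBool.encode (us.map f))).length ≤
        (2 * Polynomial.X + 2 + Lb).eval n := by
      rw [length_boolPair]
      simp only [Polynomial.eval_add, Polynomial.eval_mul, Polynomial.eval_ofNat, Polynomial.eval_X]
      omega
    have h3 := TM2Iter.eval_mono RM h2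
    have h4 : (((encodingList Bool).sumBool eb).encode (Sum.inr b : List Bool ⊕ β)).length =
        (eb.encode b).length + 1 := by
      simp [Encoding.sumBool]
    have hB : B.eval n = RM.eval ((2 * Polynomial.X + 2 + Lb).eval n) := by
      simp only [B, Polynomial.eval_comp]
    omega
  · -- (5) fuel
    have hKq : kN ≤ Kq.eval n := by rw [hkN]; exact TM2Iter.eval_mono Kq hmn
    have h1 : (us.map fun u => (N.queries O kN u).length + 2).sum ≤ us.length * (kN + 2) :=
      OracleComposition.sum_map_le_length_mul us _ _ fun u hu => by have := hvlen u hu; omega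
    have h2 : us.length * (kN + 2) ≤ qM.eval n * (Kq.eval n + 2) :=
      Nat.mul_le_mul (huslen.le.trans hA) (by omega)
    have h3 : Pd.eval n ≤ prm.padOf n := by
      have := (hprm n).2.1; rw [hPeval] at this; omega
    simp only [Pd, Polynomial.eval_add, Polynomial.eval_mul, Polynomial.eval_ofNat,
      Polynomial.eval_one] at h3
    omega
  · -- (6) micro-steps
    have hKq : kN ≤ Kq.eval n := by rw [hkN]; exact TM2Iter.eval_mono Kq hmn
    have h1 : (us.map fun u => (N.queries O kN u).length + 1).sum ≤ us.length * (kN + 2) :=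
      OracleComposition.sum_map_le_length_mul us _ _ fun u hu => by have := hvlen u hu; omega
    have h2 : us.length * (kN + 2) ≤ qM.eval n * (Kq.eval n + 2) :=
      Nat.mul_le_mul (huslen.le.trans hA) (by omega)
    have h3 : Pd.eval n ≤ prm.iterOf n := by
      have := (hprm n).2.2; rw [hPeval] at this; omega
    simp only [Pd, Polynomial.eval_add, Polynomial.eval_mul, Polynomial.eval_ofNat,
      Polynomial.eval_one] at h3
    omega

/-! ### Clocked subroutines: a total answer function for every oracle -/

/-- **The answer function realised by a clocked subroutine.** `subAnswer R qR d₀ O u` is the output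
of `R` with oracle `O` on `u` within `qR |u|` rounds, or the default `d₀` if there is none by then
(a time-out). It is a total string function — an oracle — for EVERY `O`. [Arora–Barak 2009, §3.4
with §1.4.1] [cite: AroraBarak2009, §3.4] -/
def subAnswer (R : OracleAlg (List Bool)) (qR : Polynomial ℕ) (d₀ : List Bool) (O : Oracle) :
    Oracle :=
  fun u => (R.run O (qR.eval u.length) u).getD d₀

/-- If `R` outputs within the clock, `subAnswer` is that output. [folklore] -/
theorem subAnswer_of_run_eq_some (R : OracleAlg (List Bool)) (qR : Polynomial ℕ) (d₀ : List Bool)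
    (O : Oracle) {u y : List Bool} (h : R.run O (qR.eval u.length) u = some y) :
    subAnswer R qR d₀ O u = y := by
  simp [subAnswer, h]

/-- If `R` does not output within the clock, `subAnswer` is the default. [folklore] -/
theorem subAnswer_of_run_eq_none (R : OracleAlg (List Bool)) (qR : Polynomial ℕ) (d₀ : List Bool)
    (O : Oracle) {u : List Bool} (h : R.run O (qR.eval u.length) u = none) :
    subAnswer R qR d₀ O u = d₀ := by
  simp [subAnswer, h]

/-- **The clocked subroutine computes `subAnswer` within `qR |u| + 1` rounds, against every
oracle.** [Arora–Barak 2009, §3.4 with §1.4.1] [cite: AroraBarak2009, §3.4] -/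
theorem run_clock_subAnswer (R : OracleAlg (List Bool)) (qR : Polynomial ℕ) (d₀ : List Bool)
    (O : Oracle) (u : List Bool) :
    (R.clock qR d₀).run O ((qR + 1).eval u.length) u = some (subAnswer R qR d₀ O u) := by
  have hn : qR.eval u.length < (qR + 1).eval u.length := by simp
  cases h : R.run O (qR.eval u.length) u with
  | some y =>
    rw [subAnswer_of_run_eq_some R qR d₀ O h]
    exact R.run_clock_of_run qR d₀ O u h hn.le
  | none =>
    rw [subAnswer_of_run_eq_none R qR d₀ O h]
    obtain ⟨b, hb⟩ := Option.isSome_iff_exists.1 (R.run_clock_isSome qR d₀ O u hn)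
    rw [hb, runAux_clock_eq_default R qR d₀ O u (qR.eval u.length) [] (by simp) h _ b hb]

/-- **Polynomial-time subroutines with time-outs, relative to an arbitrary oracle.** For
polynomial-time oracle algorithms `M` (the caller, outputs coded by `eb`) and `R` (the subroutine,
string outputs), polynomials `qM`, `qR` and a default answer `d₀`, there are ONE polynomial-time
oracle algorithm `C` and ONE polynomial `qC` such that for EVERY oracle `O`, input `x` and output
`b`: if `M`, with each of its queries `u` answered by `subAnswer R qR d₀ O u` (run `R` with oracle
`O` for `qR |u|` rounds, default `d₀` on a time-out), outputs `b` within `qM |x|` rounds asking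
queries of length `≤ qM |x|`, then `C` with oracle `O` outputs `b` within `qC |x|` rounds; moreover
the queries of `C` to `O` are exactly those of the clocked runs of `R`. No hypothesis restricts `O`
or the queries of `R`. (`C` is the composite of `M` with the clocked algorithm `R.clock qR d₀`, by
`exists_polyTime_compose_local` and `run_clock_subAnswer`.) [Arora–Barak 2009, §3.4 with §1.4.1;
Ladner–Lynch–Selman 1975, §2] [cite: AroraBarak2009, §3.4] [cite: LadnerLynchSelman1975, §2] -/
theorem exists_polyTime_subroutine {eb : Encoding β Bool} {M : OracleAlg β} (hM : M.IsPolyTime eb)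
    {R : OracleAlg (List Bool)} (hR : R.IsPolyTime (encodingList Bool)) (qM qR : Polynomial ℕ)
    (d₀ : List Bool) :
    ∃ C : OracleAlg β, C.IsPolyTime eb ∧ ∃ qC : Polynomial ℕ,
      ∀ (O : Oracle) (x : List Bool) (b : β),
        M.run (subAnswer R qR d₀ O) (qM.eval x.length) x = some b →
        (∀ y ∈ M.queries (subAnswer R qR d₀ O) (qM.eval x.length) x, y.length ≤ qM.eval x.length) →
        C.run O (qC.eval x.length) x = some b ∧
          C.queries O (qC.eval x.length) x =
            (M.queries (subAnswer R qR d₀ O) (qM.eval x.length) x).flatMap fun u =>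
              (R.clock qR d₀).queries O ((qR + 1).eval u.length) u := by
  obtain ⟨C, hC, qC, h⟩ :=
    exists_polyTime_compose_local hM (isPolyTime_clock (encodingList Bool) hR qR d₀) qM (qR + 1)
  exact ⟨C, hC, qC, fun O x b hrun hq =>
    h O (subAnswer R qR d₀ O) x b hrun hq fun u _ => run_clock_subAnswer R qR d₀ O u⟩

end OracleAlg

end Literature.Computability.Complexity
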